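import Summits.CriticalPhenomena.PercolationContinuityZ3.Theorems.PercNearOneGluingNoHeavyQuantFarGate3PinchRData37p1
import Summits.CriticalPhenomena.PercolationContinuityZ3.Theorems.PercNearOneGluingNoHeavyQuantFarGate3CertNParts
import HarnessLib

/-!
# QUANT lane R8, front "FAR beyond trees", layer one — THE DEGREE-THREE GATE AT THE OBSERVER: pinch chart R box-certificate DATA — pinchR_d37_k0 (prelude 2:
# the certificate and a first group of its monomial checks; the leaf theorem is in the main file)

builds on p205010 (kernel theorem, internal audit signed; external expert review pending)

Support file (`--supports stmt-CriticalPhenomena-4575`), seats `prim-quant-p1` gen 35/36.  GENERATED by `mktreeN2.py --parts`; standard axioms;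
no sorries. [this work].
-/

namespace Summit.CriticalPhenomena.PercolationContinuityZ3.Theorems

namespace Quant

set_option maxHeartbeats 4000000 in
/-- Monomial `(1,6)` of `pinchR_d37_k0`. [this work] -/
theorem pinchR_d37_k0_p16 : CertN.pairOk PinchR.spec pinchR_d37_k0 (1, 6) = true := by decide +kernel
set_option maxHeartbeats 4000000 in
/-- Monomial `(1,7)` of `pinchR_d37_k0`. [this work] -/
theorem pinchR_d37_k0_p17 : CertN.pairOk PinchR.spec pinchR_d37_k0 (1, 7) = true := by decide +kernel
set_option maxHeartbeats 4000000 in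
/-- Monomial `(2,2)` of `pinchR_d37_k0`. [this work] -/
theorem pinchR_d37_k0_p22 : CertN.pairOk PinchR.spec pinchR_d37_k0 (2, 2) = true := by decide +kernel
set_option maxHeartbeats 4000000 in
/-- Monomial `(2,3)` of `pinchR_d37_k0`. [this work] -/
theorem pinchR_d37_k0_p23 : CertN.pairOk PinchR.spec pinchR_d37_k0 (2, 3) = true := by decide +kernel
set_option maxHeartbeats 4000000 in
/-- Monomial `(2,4)` of `pinchR_d37_k0`. [this work] -/
theorem pinchR_d37_k0_p24 : CertN.pairOk PinchR.spec pinchR_d37_k0 (2, 4) = true := by decide +kernel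
set_option maxHeartbeats 4000000 in
/-- Monomial `(2,5)` of `pinchR_d37_k0`. [this work] -/
theorem pinchR_d37_k0_p25 : CertN.pairOk PinchR.spec pinchR_d37_k0 (2, 5) = true := by decide +kernel
set_option maxHeartbeats 4000000 in
/-- Monomial `(2,6)` of `pinchR_d37_k0`. [this work] -/
theorem pinchR_d37_k0_p26 : CertN.pairOk PinchR.spec pinchR_d37_k0 (2, 6) = true := by decide +kernel
set_option maxHeartbeats 4000000 in
/-- Monomial `(2,7)` of `pinchR_d37_k0`. [this work] -/
theorem pinchR_d37_k0_p27 : CertN.pairOk PinchR.spec pinchR_d37_k0 (2, 7) = true := by decide +kernel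
set_option maxHeartbeats 4000000 in
/-- Monomial `(3,3)` of `pinchR_d37_k0`. [this work] -/
theorem pinchR_d37_k0_p33 : CertN.pairOk PinchR.spec pinchR_d37_k0 (3, 3) = true := by decide +kernel
set_option maxHeartbeats 4000000 in
/-- Monomial `(3,4)` of `pinchR_d37_k0`. [this work] -/
theorem pinchR_d37_k0_p34 : CertN.pairOk PinchR.spec pinchR_d37_k0 (3, 4) = true := by decide +kernel
set_option maxHeartbeats 4000000 in
/-- Monomial `(3,5)` of `pinchR_d37_k0`. [this work] -/
theorem pinchR_d37_k0_p35 : CertN.pairOk PinchR.spec pinchR_d37_k0 (3, 5) = true := by decide +kernel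
set_option maxHeartbeats 4000000 in
/-- Monomial `(3,6)` of `pinchR_d37_k0`. [this work] -/
theorem pinchR_d37_k0_p36 : CertN.pairOk PinchR.spec pinchR_d37_k0 (3, 6) = true := by decide +kernel
set_option maxHeartbeats 4000000 in
/-- Monomial `(3,7)` of `pinchR_d37_k0`. [this work] -/
theorem pinchR_d37_k0_p37 : CertN.pairOk PinchR.spec pinchR_d37_k0 (3, 7) = true := by decide +kernel

end Quant

end Summit.CriticalPhenomena.PercolationContinuityZ3.Theorems
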